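import Mathlib
import Literature.Probability.Percolation.InterfaceLoopPolygon
import Literature.Probability.Percolation.SiteInterfaceStructure
import Literature.Probability.LatticeModels.TriangularLatticeProofs
import Summits.CriticalPhenomena.CardyFormulaZ2.Theorems.CardyMagicRigidityLoopLimitZ2EqTCFT1Local
import Summits.CriticalPhenomena.CardyFormulaZ2.Theorems.CardyMagicRigidityLoopLimitZ2EqTCFT1Walks
import HarnessLib

/-!
# Stub `stub_cft1` (S2a) of line `Sketch`, crux `LoopLimitZ2EqT` (stmt-CriticalPhenomena-4833):
# entering darts and anchored fine faces

Helper file (`--supports stmt-CriticalPhenomena-4833`), third part of (CFT1), preliminaries of the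
fellow-travelling induction of `…CFT1.lean` (again independent of the type of the loops):

* `cft_entry` — **the dart entering the coarse position `i ≤ n` of an interface loop `Γ`,
  cyclically**: step `(i + n - 1) % n` (that is `i - 1`, and `n - 1` for `i = 0`), its head face
  is `Γᵢ`, and from `Γᵢ` it is seen entering across an entry side `J'`, with open tail
  `faceVertex Γᵢ (J' + 1)` and closed head `faceVertex Γᵢ (J' + 2)`;
* `cft_index_of_getVert_eq_zero` — a face of a cycle equal to the base face sits at `0` or `n`;
* `cft_anchor_inj` — **anchored fine faces are injective**: the fine up face with cell
  `a + x + (1,1)` attached to the coarse face `G` with cell `x` (where `a = x` if `G` is an up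
  face — the middle face of the blow-up `D(x)` — and `a` is a vertex of `G` if `G` is a down face
  — the corner face of `T(a)` at the corner `2x + (2,2)`) determines `G` and `a`, by the parities
  of the two coordinates.
-/

noncomputable section

open Set

namespace Summit.CriticalPhenomena.CardyFormulaZ2.Cruxes.LoopLimitZ2EqT.HexSegment

open Literature.Probability.Percolation Literature.Probability.LatticeModels

variable {τ : SiteConfig (Site 2)} {F : HexVertex} {Γ : hexGraph.Walk F F}

/-- A non-zero element of `Fin 2` is `1`. -/
theorem cft_fin2 {a : Fin 2} (h : ¬ a = 0) : a = 1 := by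
  fin_cases a
  · exact absurd rfl h
  · rfl

/-- **The dart entering the coarse position `i ≤ n`, cyclically**: it is the dart of step
`p = (i + n - 1) % n` (`= i - 1`, or `n - 1` for `i = 0`), its head face is `Γᵢ`, and seen
from `Γᵢ` it enters across an entry side `J'` with open tail `lv p = faceVertex Γᵢ (J' + 1)`
and closed head `rv p = faceVertex Γᵢ (J' + 2)`. -/
theorem cft_entry : ∀ {τ : SiteConfig (Site 2)} {F : HexVertex} {Γ : hexGraph.Walk F F} (hΓ : IsSiteInterfaceLoop τ Γ) {i : ℕ}, i ≤ Γ.length → (i + Γ.length - 1) % Γ.length < Γ.length ∧ Γ.getVert ((i + Γ.length - 1) % Γ.length + 1) = Γ.getVert i ∧ ∃ J' : Fin 3, IsEntrySide τ (Γ.getVert i) J' ∧ hΓ.rv ((i + Γ.length - 1) % Γ.length) = faceVertex (Γ.getVert i) (J' + 2) ∧ hΓ.lv ((i + Γ.length - 1) % Γ.length) = faceVertex (Γ.getVert i) (J' + 1) := by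
  intro τ F Γ hΓ i hi
  have hn : 3 ≤ Γ.length := hΓ.isCycle.three_le_length
  have hpn : (i + Γ.length - 1) % Γ.length < Γ.length := Nat.mod_lt _ (by omega)
  have hsucc : Γ.getVert ((i + Γ.length - 1) % Γ.length + 1) = Γ.getVert i := by
    rcases Nat.eq_zero_or_pos i with rfl | hi0
    · rw [Nat.zero_add, Nat.mod_eq_of_lt (by omega), Nat.sub_add_cancel (by omega),
        SimpleGraph.Walk.getVert_length, SimpleGraph.Walk.getVert_zero]
    · rw [show i + Γ.length - 1 = (i - 1) + Γ.length by omega, Nat.add_mod_right,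
        Nat.mod_eq_of_lt (by omega), Nat.sub_add_cancel hi0]
  refine ⟨hpn, hsucc, oppIdx (Γ.getVert ((i + Γ.length - 1) % Γ.length))
    (hΓ.sideIdx ((i + Γ.length - 1) % Γ.length)), ?_, ?_, ?_⟩
  · rw [← hsucc, hΓ.getVert_succ_eq hpn]
    exact (hΓ.isExitSide_sideIdx hpn).isEntrySide_oppFace
  · rw [← hsucc, hΓ.getVert_succ_eq hpn, faceVertex_oppFace_succ_succ]
    exact hΓ.rv_eq hpn
  · rw [← hsucc, hΓ.getVert_succ_eq hpn, faceVertex_oppFace_succ]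
    exact hΓ.lv_eq hpn

/-- A face of a cycle equal to the base face is at position `0` or `n`. -/
theorem cft_index_of_getVert_eq_zero (hΓ : IsSiteInterfaceLoop τ Γ) {i : ℕ} (hi : i ≤ Γ.length)
    (h : Γ.getVert i = Γ.getVert 0) : i = 0 ∨ i = Γ.length := by
  by_cases hin : i = Γ.length
  · exact Or.inr hin
  · exact Or.inl (hΓ.isCycle.getVert_injOn' (by simp only [Set.mem_setOf_eq]; omega)
      (by simp only [Set.mem_setOf_eq]; omega) h)

/-- **Anchors are injective.** The anchored fine face `(a + x + (1,1), 0)` of a coarse face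
`G = (x, ·)` — with `a = x` for an up face, `a` a vertex of `G` for a down face — determines
`G` and `a` (parities of the coordinates). -/
theorem cft_anchor_inj {G G' : HexVertex} {a a' : Site 2}
    (ha : (G.2 = 0 ∧ a = G.1) ∨ (G.2 = 1 ∧ ∃ k, a = faceVertex G k))
    (ha' : (G'.2 = 0 ∧ a' = G'.1) ∨ (G'.2 = 1 ∧ ∃ k, a' = faceVertex G' k))
    (h : ((fun j => a j + G.1 j + 1 : Site 2), (0 : Fin 2)) =
      ((fun j => a' j + G'.1 j + 1 : Site 2), (0 : Fin 2))) : G = G' ∧ a = a' := by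
  have h0 : a 0 + G.1 0 + 1 = a' 0 + G'.1 0 + 1 := congrFun (congrArg Prod.fst h) 0
  have h1 : a 1 + G.1 1 + 1 = a' 1 + G'.1 1 + 1 := congrFun (congrArg Prod.fst h) 1
  have key : G.1 0 = G'.1 0 ∧ G.1 1 = G'.1 1 ∧ a 0 = a' 0 ∧ a 1 = a' 1 ∧ G.2 = G'.2 := by
    rcases ha with ⟨hG, rfl⟩ | ⟨hG, k, rfl⟩ <;> rcases ha' with ⟨hG', rfl⟩ | ⟨hG', k', rfl⟩
    · exact ⟨by omega, by omega, by omega, by omega, by rw [hG, hG']⟩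
    · have := cft_faceVertex_down_sub hG' k'; omega
    · have := cft_faceVertex_down_sub hG k; omega
    · have := cft_faceVertex_down_sub hG k
      have := cft_faceVertex_down_sub hG' k'
      exact ⟨by omega, by omega, by omega, by omega, by rw [hG, hG']⟩
  obtain ⟨e0, e1, e2, e3, e4⟩ := key
  refine ⟨Prod.ext (funext fun i => ?_) e4, funext fun i => ?_⟩
  · fin_cases i
    · exact e0
    · exact e1
  · fin_cases i
    · exact e2
    · exact e3

end Summit.CriticalPhenomena.CardyFormulaZ2.Cruxes.LoopLimitZ2EqT.HexSegment

end
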